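import Literature.Geometry.Lorentzian.MinkowskiStabilityCauchyProofs
import Literature.Geometry.Lorentzian.GeodesicIncompleteness
import HarnessLib

/-!
# Stability of Minkowski space (Christodoulou–Klainerman 1993 / Bieri 2010), faithful consequence form
# over vacuum Cauchy developments — the named fact, declared

`MinkowskiStabilityCauchy` vendors the global nonlinear stability of Minkowski space as the named fact
`christodoulou_klainerman_stability_minkowski_cauchy`, DEPRECATED since 2026-08-17 because its
completeness conjunct (`IsGeodesicallyComplete`, all geodesics) is stronger than the source; the
verdict clean-up recorded the corrected Lean text — the same statement with
`𝒟.metric.IsCausalGeodesicallyComplete` (Bieri's "g-completeness": *"We remark that by geodesically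
complete is denoted what in GR is called g-complete which means that every causal geodesic can be
extended for all parameter values"*, Bieri, JDG 86 (2010) = arXiv:0904.0620, p. 3, after the Global
Smallness Assumption B; quoted from the held text) — and left its DECLARATION to a cite/definition
item (a proving / verdict-clean-up seat may not mint a named fact, D-0026).  This file is that
declaration:

* `christodoulou_klainerman_bieri_stability_minkowski_cauchy` — the corrected named fact, the
  verbatim text recorded in the module docstrings of `MinkowskiStabilityCauchy` (§Verdict clean-up)
  and `MinkowskiStabilityCauchyProofs` (§1); it is literally the conclusion type of
  `christodoulou_klainerman_bieri_stability_minkowski_cauchy_of_exists` there, so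
* `christodoulou_klainerman_bieri_stability_minkowski_cauchy.of_exists` reduces it in one line to the
  PRINTED existence statement (Bieri 2010, Thm. 1, read over `VacuumCauchyDevelopment`), and
* `christodoulou_klainerman_bieri_stability_minkowski_cauchy.not_incomplete` reads off the
  singularity-theorem-facing form of the completeness conjunct: every maximal vacuum Cauchy
  development of such data is neither future null nor future timelike geodesically incomplete
  (Hawking–Ellis 1973, §8.1: a g-complete spacetime has no incomplete causal geodesic; from the
  tree's `not_isNullGeodesicallyComplete_of_isFutureNullGeodesicallyIncomplete_holds` and its
  timelike twin).  This is the "dispersive" clause that classification arguments for small data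
  consume (e.g. the decomp-fsc cell's `IsDispersiveType`).

What is NOT here (and not claimed): non-stationarity / non-periodicity of the developments of
positive-mass small data (Lichnerowicz-type and time-periodicity theorems are separate results), any
statement about light trapping or uniform escape of null rays beyond the complete-`𝓘⁺` conjunct, and
the existence theorem itself (Bieri 2010, Thm. 1 / Thm. 3; CK 1993, Thm. 10.2.1), which has no
carrier in Mathlib or `Literature` (no local existence theory for the vacuum Einstein equations) —
hence a named fact, not a theorem.

## References

* L. Bieri, *An extension of the stability theorem of the Minkowski space in general relativity*,
  J. Differential Geom. 86 (2010) 17–70 = arXiv:0904.0620 [held: `paper:arxiv-0904.0620`]: Thm. 1,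
  Global Smallness Assumption B and the remark on g-completeness (arXiv p. 3); Thm. 3 (arXiv p. 10).
  Key `Bieri2010JDG`.
* D. Christodoulou, S. Klainerman, *The global nonlinear stability of the Minkowski space*,
  Princeton Math. Ser. 41 (1993) [held]: Thm. 1.0.1 p. 16; Thms. 1.0.2–1.0.3 p. 20; Thm. 10.2.1
  p. 237.  Key `ChristodoulouKlainerman1993PMS41`.
* S. W. Hawking, G. F. R. Ellis, *The large scale structure of space-time* (1973), §8.1.
-/

noncomputable section

open Set Function Filter TopologicalSpace
open scoped Manifold ContDiff Topology ENNReal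

namespace Literature.Geometry.Lorentzian

/-- **Global nonlinear stability of Minkowski space, faithful consequence form over vacuum Cauchy
developments** (Christodoulou–Klainerman 1993 in the smallness class of Bieri 2010, restricted to
data with the Christodoulou–Klainerman fall-off; named fact).  **Sources.** Bieri, JDG 86 (2010) =
arXiv:0904.0620, Thm. 1 (arXiv p. 3: "Any asymptotically flat, maximal initial data set, with
complete metric `ḡ`, satisfying inequality (17) [Global Smallness Assumption B], where the `ε` has to
be taken sufficiently small, leads to a unique, globally hyperbolic, smooth and geodesically complete
solution of the EV equations, foliated by the level sets of a maximal time function. This development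
is globally asymptotically flat"), with her remark fixing the word (same page): "by geodesically
complete is denoted what in GR is called g-complete which means that every causal geodesic can be
extended for all parameter values", and Thm. 3 (arXiv p. 10); Christodoulou–Klainerman 1993,
Thm. 1.0.3 (p. 20, maximal S.A.F. data) and Thm. 10.2.1 (p. 237, completeness of null infinity).

**Statement.** There are a Sobolev exponent `s`, a decay weight `δ ∈ (-3/2, -1/2)`, a derivative
order `k` and `ε > 0` such that: for every initial data set `D = (h, k)` on `ℝ³ = Minkowski.slice`
solving the vacuum constraints, **maximal** (`InitialDataSet.IsMaximalData`), strongly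
asymptotically flat in the sense of Christodoulou–Klainerman on the standard end `trivialAFEnd` for
some mass `M` (`IsStronglyAsymptoticallyFlatCK`) and `ε`-close to the trivial data `(ℝ³, δ, 0)` in
the weighted Sobolev distance `H^s_δ × H^{s-1}_{δ+1}` (`dataWeightedSobolevEDist`), every **maximal
vacuum Cauchy development** `𝒟` of `D` is **causally geodesically complete**
(`LorentzianMetric.IsCausalGeodesicallyComplete`, Bieri's g-completeness), has **complete future null
infinity** in Christodoulou's sojourn form (`DataEmbedding.HasCompleteFutureNullInfinity`) and
**converges to Minkowski space** on all of its carrier in `Cᵏ` (`Spacetime.ConvergesToMinkowski …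
univ k`).  Paraphrase notes: those of the deprecated `christodoulou_klainerman_stability_minkowski_cauchy`
(`MinkowskiStabilityCauchy`: `δ = -1`, `s = 3` reproduces Bieri's class B on CK-decaying data;
`(s, δ, k, ε)` existential; only qualitative conclusions; `δ < -1/2` keeps every small mass in the
ball) — this is that `def` with the single change `IsGeodesicallyComplete 𝒟.metric.leviCivita ↦
𝒟.metric.IsCausalGeodesicallyComplete`, the text recorded there for declaration under this name.
[cite: Bieri2010JDG, Thm. 1 and the remark on g-completeness (arXiv p. 3); Thm. 3 (arXiv p. 10)] -/
def christodoulou_klainerman_bieri_stability_minkowski_cauchy : Prop :=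
  ∃ (s : ℕ), ∃ δ ∈ Set.Ioo (-3 / 2 : ℝ) (-1 / 2), ∃ (k : ℕ), ∃ ε > (0 : ℝ),
    ∀ (D : InitialDataSet 𝓘(ℝ, E3) Minkowski.slice) [D.metric.HasLeviCivita],
      D.IsVacuumConstraintSolution → D.IsMaximalData →
      (∃ M : ℝ, trivialAFEnd.IsStronglyAsymptoticallyFlatCK D M) →
      InitialDataSet.dataWeightedSobolevEDist s δ D trivialData < ENNReal.ofReal ε →
      ∀ 𝒟 : VacuumCauchyDevelopment D, 𝒟.IsMaximal → ∀ [𝒟.metric.HasLeviCivita],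
        𝒟.metric.IsCausalGeodesicallyComplete ∧
          𝒟.HasCompleteFutureNullInfinity ∧
          𝒟.toSpacetime.ConvergesToMinkowski Set.univ k

/-- **The fact follows from the printed existence statement** (Bieri 2010, Thm. 1, read over
`VacuumCauchyDevelopment`: small data lead to *a* causally geodesically complete vacuum Cauchy
development converging to Minkowski space): one line from
`christodoulou_klainerman_bieri_stability_minkowski_cauchy_of_exists` (`MinkowskiStabilityCauchyProofs`,
whose conclusion type is this fact verbatim). [cite: Bieri2010JDG, Thm. 1 and the remark on g-completeness (arXiv p. 3)] -/
theorem christodoulou_klainerman_bieri_stability_minkowski_cauchy.of_exists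
    (hex : ∃ (s : ℕ), ∃ δ ∈ Set.Ioo (-3 / 2 : ℝ) (-1 / 2), ∃ (k : ℕ), ∃ ε > (0 : ℝ),
      ∀ (D : InitialDataSet 𝓘(ℝ, E3) Minkowski.slice) [D.metric.HasLeviCivita],
        D.IsVacuumConstraintSolution → D.IsMaximalData →
        (∃ M : ℝ, trivialAFEnd.IsStronglyAsymptoticallyFlatCK D M) →
        InitialDataSet.dataWeightedSobolevEDist s δ D trivialData < ENNReal.ofReal ε →
        ∃ 𝒟₀ : VacuumCauchyDevelopment D,
          (∀ [𝒟₀.metric.HasLeviCivita], 𝒟₀.metric.IsCausalGeodesicallyComplete) ∧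
            𝒟₀.toSpacetime.ConvergesToMinkowski Set.univ k) :
    christodoulou_klainerman_bieri_stability_minkowski_cauchy :=
  christodoulou_klainerman_bieri_stability_minkowski_cauchy_of_exists hex

/-- **Small data are dispersive** (the singularity-theorem-facing reading of the completeness
conjunct): under the fact, for the same `(s, δ, ε)` every maximal vacuum Cauchy development of
maximal, CK-asymptotically-flat, `ε`-small vacuum data on `ℝ³` is neither future null geodesically
incomplete nor future timelike geodesically incomplete (`LorentzianMetric.IsFutureNullGeodesicallyIncomplete`,
`…IsFutureTimelikeGeodesicallyIncomplete`, the conclusions of the Penrose and Hawking singularity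
theorems).  Hawking–Ellis 1973, §8.1 (g-completeness excludes incomplete causal geodesics: an
incomplete maximal geodesic would coincide with the complete one with the same initial data);
Bieri 2010, Thm. 1. [cite: HawkingEllis1973, §8.1, pp. 257–258] -/
theorem christodoulou_klainerman_bieri_stability_minkowski_cauchy.not_incomplete
    (h : christodoulou_klainerman_bieri_stability_minkowski_cauchy) :
    ∃ (s : ℕ), ∃ δ ∈ Set.Ioo (-3 / 2 : ℝ) (-1 / 2), ∃ ε > (0 : ℝ),
      ∀ (D : InitialDataSet 𝓘(ℝ, E3) Minkowski.slice) [D.metric.HasLeviCivita],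
        D.IsVacuumConstraintSolution → D.IsMaximalData →
        (∃ M : ℝ, trivialAFEnd.IsStronglyAsymptoticallyFlatCK D M) →
        InitialDataSet.dataWeightedSobolevEDist s δ D trivialData < ENNReal.ofReal ε →
        ∀ 𝒟 : VacuumCauchyDevelopment D, 𝒟.IsMaximal → ∀ [𝒟.metric.HasLeviCivita],
          ¬ 𝒟.metric.IsFutureNullGeodesicallyIncomplete 𝒟.timeOrientation ∧
            ¬ 𝒟.metric.IsFutureTimelikeGeodesicallyIncomplete 𝒟.timeOrientation := by
  obtain ⟨s, δ, hδ, k, ε, hε, H⟩ := h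
  refine ⟨s, δ, hδ, ε, hε, fun D _ hD hmax hsaf hdist 𝒟 h𝒟 _ ↦ ?_⟩
  obtain ⟨hcc, -, -⟩ := H D hD hmax hsaf hdist 𝒟 h𝒟
  obtain ⟨htl, hnull⟩ := (𝒟.metric.isCausalGeodesicallyComplete_iff).1 hcc
  haveI := LorentzianMetric.contMDiffCovariantDerivative_leviCivita_one 𝒟.metric
  exact ⟨fun hinc ↦
      LorentzianMetric.not_isNullGeodesicallyComplete_of_isFutureNullGeodesicallyIncomplete_holds
        𝒟.timeOrientation hinc hnull,
    fun hinc ↦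
      LorentzianMetric.not_isTimelikeGeodesicallyComplete_of_isFutureTimelikeGeodesicallyIncomplete_holds
        𝒟.timeOrientation hinc htl⟩

end Literature.Geometry.Lorentzian

end

/-!
## Scope caveats (T-440-1, AUDIT-T440.md): what print supports, conjunct by conjunct

Record of the facts-audit `AUDIT-T440.md` @4d3af8e49aad3e70 (item T-440-1, 2026-08-31) of the
conclusion conjuncts of
`christodoulou_klainerman_bieri_stability_minkowski_cauchy` (same findings for the class-B sibling
`bieri_stability_minkowski_cauchy_classB`); statements only, no declaration is changed.
* The order `k` is INERT: the fact is equivalent to its `k = 0` instance (`…_iff_zero` below, via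
  `Spacetime.ConvergesTo.of_le`) — DERIVED-IN-TREE.
* (c1) `IsCausalGeodesicallyComplete` — VERBATIM at the witnesses `(s, δ) = (3, -1)`: Bieri,
  arXiv:0904.0620, Thm. 1 and Thm. 3 with the remark "by geodesically complete is denoted what in GR
  is called g-complete which means that every causal geodesic can be extended for all parameter
  values" (p. 3); class B contains the hypothesis block at `δ = -1` (completeness of `ḡ` from the
  `H³₋₁`-smallness); one complete development ⇒ every maximal one: `MinkowskiStabilityCauchyProofs`.
* (c2) `HasCompleteFutureNullInfinity` (sojourn form) — DERIVED-IN-TREE from (c1) by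
  `LorentzianMetric.hasCompleteFutureNullInfinity_of_isNullGeodesicallyComplete` (`NullInfinity`).
* (c3) `ConvergesToMinkowski univ 0` — uniform `C⁰` decay of `Ψ^* g − η` on the whole late
  hyperplanes `{x⁰ = τ}` of ONE global late chart (`Spacetime.IsLateEmbedding`, `deviationCk`) —
  PARAPHRASE, printed by NO audited source whose data class contains the hypothesis block: Bieri
  2010 and Christodoulou–Klainerman 1993 are chart-free by design (Bieri p. 3 "we do not need any
  preferred coordinate system"; CK Thm. 1.0.1, p. 16: "globally asymptotically flat" = curvature → 0
  along causal and spacelike geodesics; nearest metric-level print: per-cone limits, CK p. 384);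
  Luk–Oh–Warnick arXiv:2606.31090 (class (i) contains the block) bound the metric, (1.6), only in a
  centre-normalised Newman–Unti gauge whose components "diverge(!) from the Minkowskian values as
  r → ∞" ((1.2), p. 2); Lindblad–Rodnianski, Ann. of Math. 171 (2010) = arXiv:math/0411109,
  Thm. 1.1 print exactly this shape ("there exists a global system of coordinates", with
  `|Z^I h¹| ≤ C ε (1+t+r)^{-1+Cε}`) for a smaller-weight, mass-subtracted class NOT containing the
  block (nearest print, non-containing class). Getting (c3) from the class-B estimates needs an unprinted late-chart construction
  (argument A-c3 of the audit). A consumer BY NAME of (c1)/(c2) only (e.g. `….not_incomplete`)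
  stands on printed ground; (c3) is an unprinted paraphrase carried by the named fact.
-/

open scoped Manifold

namespace Literature.Geometry.Lorentzian

/-- **The derivative order in the stability fact is inert**: the fact is equivalent to its `k = 0`
instance (uniform `C⁰` decay of the metric deviation on the late hyperplanes of one global late
chart), since `Cᵏ` convergence to the Minkowski background gives `C⁰` convergence in the same chart
(`Spacetime.ConvergesTo.of_le`) and `k := 0` is a witness. Reading lemma of the audit T-440-1
(module docstring §Scope caveats): Bieri 2010, Thm. 1 (arXiv p. 3) is the printed support of the
first conjunct only. [cite: Bieri2010JDG, Thm. 1 and the remark on g-completeness (arXiv p. 3)] -/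
theorem christodoulou_klainerman_bieri_stability_minkowski_cauchy_iff_zero :
    christodoulou_klainerman_bieri_stability_minkowski_cauchy ↔
      ∃ (s : ℕ), ∃ δ ∈ Set.Ioo (-3 / 2 : ℝ) (-1 / 2), ∃ ε > (0 : ℝ),
        ∀ (D : InitialDataSet 𝓘(ℝ, E3) Minkowski.slice) [D.metric.HasLeviCivita],
          D.IsVacuumConstraintSolution → D.IsMaximalData →
          (∃ M : ℝ, trivialAFEnd.IsStronglyAsymptoticallyFlatCK D M) →
          InitialDataSet.dataWeightedSobolevEDist s δ D trivialData < ENNReal.ofReal ε →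
          ∀ 𝒟 : VacuumCauchyDevelopment D, 𝒟.IsMaximal → ∀ [𝒟.metric.HasLeviCivita],
            𝒟.metric.IsCausalGeodesicallyComplete ∧
              𝒟.HasCompleteFutureNullInfinity ∧
              𝒟.toSpacetime.ConvergesToMinkowski Set.univ 0 := by
  refine ⟨fun ⟨s, δ, hδ, k, ε, hε, H⟩ ↦ ⟨s, δ, hδ, ε, hε, fun D _ hD hm hF hd 𝒟 h𝒟 _ ↦ ?_⟩,
    fun ⟨s, δ, hδ, ε, hε, H⟩ ↦ ⟨s, δ, hδ, 0, ε, hε, H⟩⟩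
  obtain ⟨hcc, hscri, hconv⟩ := H D hD hm hF hd 𝒟 h𝒟
  exact ⟨hcc, hscri, Spacetime.ConvergesTo.of_le hconv (Nat.zero_le k)⟩

end Literature.Geometry.Lorentzian
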